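import Literature.Geometry.Riemannian.DeformedCylinderMetric
import Literature.Geometry.Lorentzian.AsymptoticFlatnessProofs
import HarnessLib

/-!
# The deformed generalized cylinder of Bär–Hanke's normal-form theorem (2023, §3, Props. 23, 26)

Topic `Literature/Geometry/Riemannian`. A brick (K2 of the notes) of the proof of the named fact
`Literature.Geometry.Riemannian.BarHanke2023_thm27_umbilicNormalForm` (`BaerHankeNormalForm.lean`;
Bär–Hanke, *Boundary conditions for scalar curvature*, §3, Thm. 27, umbilic endpoint). In
boundary normal coordinates the metric is a generalized cylinder `G = g_t + dt²` on `N × ℝ`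
(§3, (7)); with `h = -½ ġ₀` (the second fundamental form, (8)) and `k = μ g₀`, Bär–Hanke's
deformations of Prop. 23 (`C`-normalisation, `g_t ↝ g₀ - 2t h - C t² g₀` near `t = 0`) and
Prop. 26 (formula (15): `γ_t = (1 - Ct²) g₀ - 2t h + 2 χ_δ(t) (h - k)`) replace the slice family
near `t = 0` by

  `P_t = g₀ + (t - χ(t)) ġ₀ - (C t² + 2 μ χ(t)) g₀ = g₀ - 2t h - C t² g₀ + 2 χ(t) (h - k)`,

interpolated with `g_t` by a cut-off `a(t)` in time. This file constructs the resulting metric as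
a smooth Riemannian generalized cylinder on `N × ℝ` (the STRUCTURAL part; the scalar curvature
estimates are separate bricks):

* `exists_cylNormalDeform` — for a Riemannian cylinder metric `G`, a smooth symmetric field `B`
  on `TN` (downstream `B = ġ₀`, `CylinderSliceDerivative.lean`), smooth `μ : N → ℝ`, smooth
  `a, χ : ℝ → ℝ` with `0 ≤ a ≤ 1`, a constant `C`, and positivity of `P_t(z)` wherever
  `a(t) ≠ 0`, there is a Riemannian `C^∞` metric `G'` on `N × ℝ` with the cylinder property and
  `G'_{(z,t)}(v, w) = (1 - a t) G_{(z,t)}(v, w) + a t (P_t(z)(v₁, w₁) + v₂ w₂)`;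
* `cylNormalDeform_val_of_eq_zero`, `cylNormalDeform_hor_of_eq_one` — hence `G' = G` where
  `a = 0`, and `G'_t = (1 - 2 μ t - C t²) g₀` on horizontal vectors where `a(t) = 1`, `χ(t) = t`
  (Bär–Hanke's `C`-normal form with `II = k = μ g₀`, Def. 21 / Thm. 27 (d), (f)).

The fields `g₀`, `B`, `dt²` on `N × ℝ` are pullbacks of smooth sections along the projections
(`contMDiff_pullbackBilin_of_contMDiff`, `contMDiff_pullbackBilin_holds`), and `G'` is a sum of
smooth multiples of smooth sections (as in `exists_cylDeform`, `DeformedCylinderMetric.lean`).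
Everything is proved; no definitions, no named facts (D-0026).

## References

* C. Bär, B. Hanke, *Boundary conditions for scalar curvature*, arXiv:2012.09127, §3, (7)–(8),
  Def. 21, Prop. 23, (15) in the proof of Prop. 26, Thm. 27. [BarHanke2023]
* B. O'Neill, *Semi-Riemannian geometry* (1983), Ch. 3, Def. 3.9 (pullback of covariant
  tensors). [ONeill1983]
-/

set_option maxSynthPendingDepth 3

noncomputable section

open Bundle Set Filter Function Metric
open scoped Manifold ContDiff Topology RealInnerProductSpace

namespace Literature.Geometry.Riemannian

open Literature.Geometry.Lorentzian
open Literature.Geometry.Lorentzian.PseudoRiemannianMetric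

variable {E' : Type*} [NormedAddCommGroup E'] [NormedSpace ℝ E']
  {H' : Type*} [TopologicalSpace H'] {I' : ModelWithCorners ℝ E' H'}
  {N : Type*} [TopologicalSpace N] [ChartedSpace H' N] [IsManifold I' ∞ N]
  (G : PseudoRiemannianMetric (I'.prod 𝓘(ℝ, ℝ)) ∞ (E' × ℝ)
    (TangentSpace (I'.prod 𝓘(ℝ, ℝ)) : N × ℝ → Type _))

set_option maxHeartbeats 800000 in -- a long construction (four smooth sections and their algebra)
/-- **The deformed generalized cylinder** (Bär–Hanke 2023, §3, Props. 23 and 26, the metrics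
`g₀ - 2th - Ct²g₀ + 2χ_δ(t)(h - k) ⊕ dt²` interpolated with `g_t ⊕ dt²` by a time cut-off `a`).
Let `G` be a Riemannian metric on `N × ℝ` with the cylinder property, `B` a smooth symmetric
field of bilinear forms on `TN`, `μ : N → ℝ` smooth, `a, χ : ℝ → ℝ` smooth with `0 ≤ a ≤ 1`,
`C` a constant, and suppose the horizontal target forms
`P_t(z) = (1 - (Ct² + 2μ(z)χ(t))) g₀(z) + (t - χ(t)) B(z)` (`g₀(z)(v,w) = G_{(z,0)}((v,0),(w,0))`)
are positive definite whenever `a(t) ≠ 0`. Then there is a Riemannian `C^∞` metric `G'` on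
`N × ℝ` with the cylinder property and
`G'_{(z,t)}(v,w) = (1 - a(t)) G_{(z,t)}(v,w) + a(t) (P_t(z)(v₁,w₁) + v₂w₂)`.
[cite: BarHanke2023, §3, Prop. 23 and (15)] -/
theorem exists_cylNormalDeform (hG : G.IsRiemannian)
    (hcyl : ∀ (p : N × ℝ) (v w : TangentSpace (I'.prod 𝓘(ℝ, ℝ)) p),
      G.val p v w = G.val p ((v.1, 0) : TangentSpace (I'.prod 𝓘(ℝ, ℝ)) p)
        ((w.1, 0) : TangentSpace (I'.prod 𝓘(ℝ, ℝ)) p) + v.2 * w.2)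
    (B : Π z : N, TangentSpace I' z →L[ℝ] TangentSpace I' z →L[ℝ] ℝ)
    (hB : ContMDiff I' (I'.prod 𝓘(ℝ, E' →L[ℝ] E' →L[ℝ] ℝ)) ∞
      (fun z : N ↦ TotalSpace.mk' (E' →L[ℝ] E' →L[ℝ] ℝ)
        (E := fun z : N ↦ TangentSpace I' z →L[ℝ] TangentSpace I' z →L[ℝ] ℝ) z (B z)))
    (hBsymm : ∀ (z : N) (v w : TangentSpace I' z), B z v w = B z w v)
    (μ : N → ℝ) (hμ : ContMDiff I' 𝓘(ℝ, ℝ) ∞ μ)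
    (a χ : ℝ → ℝ) (ha : ContDiff ℝ ∞ a) (hχ : ContDiff ℝ ∞ χ) (ha01 : ∀ t, 0 ≤ a t ∧ a t ≤ 1)
    (C : ℝ)
    (hPD : ∀ (z : N) (t : ℝ), a t ≠ 0 → ∀ v : E', v ≠ 0 →
      0 < (1 - (C * t ^ 2 + 2 * μ z * χ t)) *
          G.val (z, (0 : ℝ)) ((v, 0) : TangentSpace (I'.prod 𝓘(ℝ, ℝ)) (z, (0 : ℝ)))
            ((v, 0) : TangentSpace (I'.prod 𝓘(ℝ, ℝ)) (z, (0 : ℝ))) +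
        (t - χ t) * B z v v) :
    ∃ G' : PseudoRiemannianMetric (I'.prod 𝓘(ℝ, ℝ)) ∞ (E' × ℝ)
        (TangentSpace (I'.prod 𝓘(ℝ, ℝ)) : N × ℝ → Type _),
      G'.IsRiemannian ∧
      (∀ (p : N × ℝ) (v w : TangentSpace (I'.prod 𝓘(ℝ, ℝ)) p),
        G'.val p v w = G'.val p ((v.1, 0) : TangentSpace (I'.prod 𝓘(ℝ, ℝ)) p)
          ((w.1, 0) : TangentSpace (I'.prod 𝓘(ℝ, ℝ)) p) + v.2 * w.2) ∧
      ∀ (z : N) (t : ℝ) (v w : TangentSpace (I'.prod 𝓘(ℝ, ℝ)) (z, t)),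
        G'.val (z, t) v w = (1 - a t) * G.val (z, t) v w +
          a t * ((1 - (C * t ^ 2 + 2 * μ z * χ t)) *
              G.val (z, (0 : ℝ)) ((v.1, 0) : TangentSpace (I'.prod 𝓘(ℝ, ℝ)) (z, (0 : ℝ)))
                ((w.1, 0) : TangentSpace (I'.prod 𝓘(ℝ, ℝ)) (z, (0 : ℝ))) +
            (t - χ t) * B z v.1 w.1 + v.2 * w.2) := by
  -- the slice `z ↦ (z, 0)` and the field `g₀` on `N`, then on `N × ℝ` (pullback along `Prod.fst`)
  have hsl : ContMDiff I' (I'.prod 𝓘(ℝ, ℝ)) (∞ + 1) (fun z : N ↦ ((z, (0 : ℝ)) : N × ℝ)) :=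
    contMDiff_id.prodMk contMDiff_const
  have hfst : ContMDiff (I'.prod 𝓘(ℝ, ℝ)) I' (∞ + 1) (Prod.fst : N × ℝ → N) := contMDiff_fst
  obtain ⟨g₀, hg₀apply, hg₀s⟩ : ∃ g₀ : Π z : N, TangentSpace I' z →L[ℝ] TangentSpace I' z →L[ℝ] ℝ,
      (∀ (z : N) (v w : E'), g₀ z v w =
        G.val (z, (0 : ℝ)) ((v, 0) : TangentSpace (I'.prod 𝓘(ℝ, ℝ)) (z, (0 : ℝ)))
          ((w, 0) : TangentSpace (I'.prod 𝓘(ℝ, ℝ)) (z, (0 : ℝ)))) ∧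
      ContMDiff I' (I'.prod 𝓘(ℝ, E' →L[ℝ] E' →L[ℝ] ℝ)) ∞
        (fun z : N ↦ TotalSpace.mk' (E' →L[ℝ] E' →L[ℝ] ℝ)
          (E := fun z : N ↦ TangentSpace I' z →L[ℝ] TangentSpace I' z →L[ℝ] ℝ) z (g₀ z)) :=
    ⟨pullbackBilin (I := I'.prod 𝓘(ℝ, ℝ)) (I' := I') (fun z : N ↦ ((z, (0 : ℝ)) : N × ℝ)) G.val,
      fun z v w ↦ by rw [pullbackBilin_apply, mfderiv_cylSlice_apply, mfderiv_cylSlice_apply],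
      contMDiff_pullbackBilin_holds (I := I'.prod 𝓘(ℝ, ℝ)) (M := N × ℝ) (I' := I') (N := N) _
        hsl G⟩
  obtain ⟨A, hAapply, hAs⟩ : ∃ A : Π p : N × ℝ, TangentSpace (I'.prod 𝓘(ℝ, ℝ)) p →L[ℝ]
      TangentSpace (I'.prod 𝓘(ℝ, ℝ)) p →L[ℝ] ℝ,
      (∀ (p : N × ℝ) (v w : TangentSpace (I'.prod 𝓘(ℝ, ℝ)) p), A p v w =
        G.val (p.1, (0 : ℝ)) ((v.1, 0) : TangentSpace (I'.prod 𝓘(ℝ, ℝ)) (p.1, (0 : ℝ)))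
          ((w.1, 0) : TangentSpace (I'.prod 𝓘(ℝ, ℝ)) (p.1, (0 : ℝ)))) ∧
      ContMDiff (I'.prod 𝓘(ℝ, ℝ))
        ((I'.prod 𝓘(ℝ, ℝ)).prod 𝓘(ℝ, (E' × ℝ) →L[ℝ] (E' × ℝ) →L[ℝ] ℝ)) ∞
        (fun q : N × ℝ ↦ TotalSpace.mk' ((E' × ℝ) →L[ℝ] (E' × ℝ) →L[ℝ] ℝ)
          (E := fun q : N × ℝ ↦ TangentSpace (I'.prod 𝓘(ℝ, ℝ)) q →L[ℝ]
            TangentSpace (I'.prod 𝓘(ℝ, ℝ)) q →L[ℝ] ℝ) q (A q)) :=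
    ⟨pullbackBilin (I := I') (I' := I'.prod 𝓘(ℝ, ℝ)) (Prod.fst : N × ℝ → N) g₀,
      fun p v w ↦ by rw [pullbackBilin_apply, mfderiv_fst]; exact hg₀apply p.1 v.1 w.1,
      contMDiff_pullbackBilin_of_contMDiff hfst hg₀s⟩
  -- the field `B` on `N × ℝ`
  obtain ⟨Bh, hBhapply, hBhs⟩ : ∃ Bh : Π p : N × ℝ, TangentSpace (I'.prod 𝓘(ℝ, ℝ)) p →L[ℝ]
      TangentSpace (I'.prod 𝓘(ℝ, ℝ)) p →L[ℝ] ℝ,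
      (∀ (p : N × ℝ) (v w : TangentSpace (I'.prod 𝓘(ℝ, ℝ)) p), Bh p v w = B p.1 v.1 w.1) ∧
      ContMDiff (I'.prod 𝓘(ℝ, ℝ))
        ((I'.prod 𝓘(ℝ, ℝ)).prod 𝓘(ℝ, (E' × ℝ) →L[ℝ] (E' × ℝ) →L[ℝ] ℝ)) ∞
        (fun q : N × ℝ ↦ TotalSpace.mk' ((E' × ℝ) →L[ℝ] (E' × ℝ) →L[ℝ] ℝ)
          (E := fun q : N × ℝ ↦ TangentSpace (I'.prod 𝓘(ℝ, ℝ)) q →L[ℝ]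
            TangentSpace (I'.prod 𝓘(ℝ, ℝ)) q →L[ℝ] ℝ) q (Bh q)) :=
    ⟨pullbackBilin (I := I') (I' := I'.prod 𝓘(ℝ, ℝ)) (Prod.fst : N × ℝ → N) B,
      fun p v w ↦ by rw [pullbackBilin_apply, mfderiv_fst]; rfl,
      contMDiff_pullbackBilin_of_contMDiff hfst hB⟩
  -- the field `dt²`
  obtain ⟨D, hDapply, hDs⟩ : ∃ D : Π p : N × ℝ, TangentSpace (I'.prod 𝓘(ℝ, ℝ)) p →L[ℝ]
      TangentSpace (I'.prod 𝓘(ℝ, ℝ)) p →L[ℝ] ℝ,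
      (∀ (p : N × ℝ) (v w : TangentSpace (I'.prod 𝓘(ℝ, ℝ)) p), D p v w = v.2 * w.2) ∧
      ContMDiff (I'.prod 𝓘(ℝ, ℝ))
        ((I'.prod 𝓘(ℝ, ℝ)).prod 𝓘(ℝ, (E' × ℝ) →L[ℝ] (E' × ℝ) →L[ℝ] ℝ)) ∞
        (fun q : N × ℝ ↦ TotalSpace.mk' ((E' × ℝ) →L[ℝ] (E' × ℝ) →L[ℝ] ℝ)
          (E := fun q : N × ℝ ↦ TangentSpace (I'.prod 𝓘(ℝ, ℝ)) q →L[ℝ]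
            TangentSpace (I'.prod 𝓘(ℝ, ℝ)) q →L[ℝ] ℝ) q (D q)) := by
    refine ⟨pullbackBilin (I := 𝓘(ℝ, ℝ)) (I' := I'.prod 𝓘(ℝ, ℝ)) (Prod.snd : N × ℝ → ℝ)
      (euclideanMetric ℝ).val, fun p v w ↦ ?_,
      contMDiff_pullbackBilin_holds (I := 𝓘(ℝ, ℝ)) (M := ℝ) (I' := I'.prod 𝓘(ℝ, ℝ)) (N := N × ℝ)
        Prod.snd contMDiff_snd (euclideanMetric ℝ)⟩
    rw [pullbackBilin_apply, euclideanMetric_apply, mfderiv_snd]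
    show ⟪v.2, w.2⟫ = v.2 * w.2
    rw [real_inner_comm]
    rfl
  -- the coefficient functions are smooth
  have has : ContMDiff (I'.prod 𝓘(ℝ, ℝ)) 𝓘(ℝ, ℝ) ∞ (fun p : N × ℝ ↦ a p.2) :=
    ha.contMDiff.comp contMDiff_snd
  have hχs : ContMDiff (I'.prod 𝓘(ℝ, ℝ)) 𝓘(ℝ, ℝ) ∞ (fun p : N × ℝ ↦ χ p.2) :=
    hχ.contMDiff.comp contMDiff_snd
  have hts : ContMDiff (I'.prod 𝓘(ℝ, ℝ)) 𝓘(ℝ, ℝ) ∞ (fun p : N × ℝ ↦ p.2) := contMDiff_snd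
  have hμs : ContMDiff (I'.prod 𝓘(ℝ, ℝ)) 𝓘(ℝ, ℝ) ∞ (fun p : N × ℝ ↦ μ p.1) := hμ.comp contMDiff_fst
  have hc₀s : ContMDiff (I'.prod 𝓘(ℝ, ℝ)) 𝓘(ℝ, ℝ) ∞ (fun p : N × ℝ ↦ 1 - a p.2) :=
    contMDiff_const.sub has
  have hc₁s : ContMDiff (I'.prod 𝓘(ℝ, ℝ)) 𝓘(ℝ, ℝ) ∞
      (fun p : N × ℝ ↦ a p.2 * (1 - (C * p.2 ^ 2 + 2 * μ p.1 * χ p.2))) :=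
    has.mul (contMDiff_const.sub ((contMDiff_const.mul (hts.pow 2)).add
      ((contMDiff_const.mul hμs).mul hχs)))
  have hc₂s : ContMDiff (I'.prod 𝓘(ℝ, ℝ)) 𝓘(ℝ, ℝ) ∞ (fun p : N × ℝ ↦ a p.2 * (p.2 - χ p.2)) :=
    has.mul (hts.sub hχs)
  -- the deformed field: values and smoothness
  obtain ⟨val, hvapply', hsmooth⟩ : ∃ val : Π p : N × ℝ, TangentSpace (I'.prod 𝓘(ℝ, ℝ)) p →L[ℝ]
      TangentSpace (I'.prod 𝓘(ℝ, ℝ)) p →L[ℝ] ℝ,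
      (∀ (p : N × ℝ) (v w : TangentSpace (I'.prod 𝓘(ℝ, ℝ)) p),
        val p v w = (1 - a p.2) * G.val p v w +
          a p.2 * ((1 - (C * p.2 ^ 2 + 2 * μ p.1 * χ p.2)) *
              G.val (p.1, (0 : ℝ)) ((v.1, 0) : TangentSpace (I'.prod 𝓘(ℝ, ℝ)) (p.1, (0 : ℝ)))
                ((w.1, 0) : TangentSpace (I'.prod 𝓘(ℝ, ℝ)) (p.1, (0 : ℝ))) +
            (p.2 - χ p.2) * B p.1 v.1 w.1 + v.2 * w.2)) ∧
      ContMDiff (I'.prod 𝓘(ℝ, ℝ))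
        ((I'.prod 𝓘(ℝ, ℝ)).prod 𝓘(ℝ, (E' × ℝ) →L[ℝ] (E' × ℝ) →L[ℝ] ℝ)) ∞
        (fun q : N × ℝ ↦ TotalSpace.mk' ((E' × ℝ) →L[ℝ] (E' × ℝ) →L[ℝ] ℝ)
          (E := fun q : N × ℝ ↦ TangentSpace (I'.prod 𝓘(ℝ, ℝ)) q →L[ℝ]
            TangentSpace (I'.prod 𝓘(ℝ, ℝ)) q →L[ℝ] ℝ) q (val q)) := by
    refine ⟨fun p ↦ (1 - a p.2) • G.val p +
        (a p.2 * (1 - (C * p.2 ^ 2 + 2 * μ p.1 * χ p.2))) • A p +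
        (a p.2 * (p.2 - χ p.2)) • Bh p + a p.2 • D p, fun p v w ↦ ?_, fun p ↦ ?_⟩
    · simp only [_root_.add_apply, _root_.smul_apply, smul_eq_mul, hAapply, hBhapply, hDapply]
      ring
    · have h0 : ContMDiffAt (I'.prod 𝓘(ℝ, ℝ))
          ((I'.prod 𝓘(ℝ, ℝ)).prod 𝓘(ℝ, (E' × ℝ) →L[ℝ] (E' × ℝ) →L[ℝ] ℝ)) ∞
          (fun q : N × ℝ ↦ TotalSpace.mk' ((E' × ℝ) →L[ℝ] (E' × ℝ) →L[ℝ] ℝ)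
            (E := fun q : N × ℝ ↦ TangentSpace (I'.prod 𝓘(ℝ, ℝ)) q →L[ℝ]
              TangentSpace (I'.prod 𝓘(ℝ, ℝ)) q →L[ℝ] ℝ) q
              (((fun p : N × ℝ ↦ 1 - a p.2) • G.val) q)) p :=
        (hc₀s p).smul_section (G.contMDiff p)
      have h1 : ContMDiffAt (I'.prod 𝓘(ℝ, ℝ))
          ((I'.prod 𝓘(ℝ, ℝ)).prod 𝓘(ℝ, (E' × ℝ) →L[ℝ] (E' × ℝ) →L[ℝ] ℝ)) ∞
          (fun q : N × ℝ ↦ TotalSpace.mk' ((E' × ℝ) →L[ℝ] (E' × ℝ) →L[ℝ] ℝ)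
            (E := fun q : N × ℝ ↦ TangentSpace (I'.prod 𝓘(ℝ, ℝ)) q →L[ℝ]
              TangentSpace (I'.prod 𝓘(ℝ, ℝ)) q →L[ℝ] ℝ) q
              (((fun p : N × ℝ ↦ a p.2 * (1 - (C * p.2 ^ 2 + 2 * μ p.1 * χ p.2))) • A) q)) p :=
        (hc₁s p).smul_section (hAs p)
      have h2 : ContMDiffAt (I'.prod 𝓘(ℝ, ℝ))
          ((I'.prod 𝓘(ℝ, ℝ)).prod 𝓘(ℝ, (E' × ℝ) →L[ℝ] (E' × ℝ) →L[ℝ] ℝ)) ∞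
          (fun q : N × ℝ ↦ TotalSpace.mk' ((E' × ℝ) →L[ℝ] (E' × ℝ) →L[ℝ] ℝ)
            (E := fun q : N × ℝ ↦ TangentSpace (I'.prod 𝓘(ℝ, ℝ)) q →L[ℝ]
              TangentSpace (I'.prod 𝓘(ℝ, ℝ)) q →L[ℝ] ℝ) q
              (((fun p : N × ℝ ↦ a p.2 * (p.2 - χ p.2)) • Bh) q)) p :=
        (hc₂s p).smul_section (hBhs p)
      have h3 : ContMDiffAt (I'.prod 𝓘(ℝ, ℝ))
          ((I'.prod 𝓘(ℝ, ℝ)).prod 𝓘(ℝ, (E' × ℝ) →L[ℝ] (E' × ℝ) →L[ℝ] ℝ)) ∞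
          (fun q : N × ℝ ↦ TotalSpace.mk' ((E' × ℝ) →L[ℝ] (E' × ℝ) →L[ℝ] ℝ)
            (E := fun q : N × ℝ ↦ TangentSpace (I'.prod 𝓘(ℝ, ℝ)) q →L[ℝ]
              TangentSpace (I'.prod 𝓘(ℝ, ℝ)) q →L[ℝ] ℝ) q
              (((fun p : N × ℝ ↦ a p.2) • D) q)) p :=
        (has p).smul_section (hDs p)
      exact ((h0.add_section h1).add_section h2).add_section h3
  have hvapply : ∀ (z : N) (t : ℝ) (v w : TangentSpace (I'.prod 𝓘(ℝ, ℝ)) (z, t)),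
      val (z, t) v w = (1 - a t) * G.val (z, t) v w +
        a t * ((1 - (C * t ^ 2 + 2 * μ z * χ t)) *
            G.val (z, (0 : ℝ)) ((v.1, 0) : TangentSpace (I'.prod 𝓘(ℝ, ℝ)) (z, (0 : ℝ)))
              ((w.1, 0) : TangentSpace (I'.prod 𝓘(ℝ, ℝ)) (z, (0 : ℝ))) +
          (t - χ t) * B z v.1 w.1 + v.2 * w.2) := fun z t v w ↦ hvapply' (z, t) v w
  -- positivity
  have hvpos : ∀ (p : N × ℝ) (v : TangentSpace (I'.prod 𝓘(ℝ, ℝ)) p), v ≠ 0 → 0 < val p v v := by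
    rintro ⟨z, t⟩ v hv
    rw [hvapply]
    have hGpos : 0 < G.val (z, t) v v := hG _ v hv
    obtain ⟨ha0, ha1⟩ := ha01 t
    by_cases hat : a t = 0
    · rw [hat, sub_zero, one_mul, zero_mul, add_zero]
      exact hGpos
    · -- the bracket is positive
      have hbr : 0 < (1 - (C * t ^ 2 + 2 * μ z * χ t)) *
            G.val (z, (0 : ℝ)) ((v.1, 0) : TangentSpace (I'.prod 𝓘(ℝ, ℝ)) (z, (0 : ℝ)))
              ((v.1, 0) : TangentSpace (I'.prod 𝓘(ℝ, ℝ)) (z, (0 : ℝ))) +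
          (t - χ t) * B z v.1 v.1 + v.2 * v.2 := by
        by_cases h1 : v.1 = 0
        · have h2 : v.2 ≠ 0 := fun h0 ↦ hv (Prod.ext h1 h0)
          have h2' : 0 < v.2 * v.2 := mul_self_pos.2 h2
          have hz : G.val (z, (0 : ℝ)) ((v.1, 0) : TangentSpace (I'.prod 𝓘(ℝ, ℝ)) (z, (0 : ℝ)))
              ((v.1, 0) : TangentSpace (I'.prod 𝓘(ℝ, ℝ)) (z, (0 : ℝ))) = 0 := by
            rw [h1]; exact cyl_val_mk_zero_left G (z, (0 : ℝ)) _
          have hB0 : B z v.1 v.1 = 0 := by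
            rw [h1]
            show B z (0 : TangentSpace I' z) (0 : TangentSpace I' z) = 0
            rw [map_zero]
          rw [hz, hB0, mul_zero, mul_zero, zero_add, zero_add]
          exact h2'
        · exact add_pos_of_pos_of_nonneg (hPD z t hat v.1 h1) (mul_self_nonneg v.2)
      have ha0' : 0 < a t := lt_of_le_of_ne ha0 (Ne.symm hat)
      exact add_pos_of_nonneg_of_pos (mul_nonneg (sub_nonneg.2 ha1) hGpos.le) (mul_pos ha0' hbr)
  refine ⟨⟨val, ?_, ?_, hsmooth⟩, fun p v hv ↦ hvpos p v hv, ?_, hvapply⟩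
  · -- symmetry
    rintro ⟨z, t⟩ v w
    have e1 := G.symm (z, t) v w
    have e2 := G.symm (z, (0 : ℝ)) ((v.1, 0) : TangentSpace (I'.prod 𝓘(ℝ, ℝ)) (z, (0 : ℝ)))
      ((w.1, 0) : TangentSpace (I'.prod 𝓘(ℝ, ℝ)) (z, (0 : ℝ)))
    have e3 := hBsymm z v.1 w.1
    rw [hvapply, hvapply, e1, e2, e3, mul_comm v.2 w.2]
  · -- nondegeneracy
    intro p v hv
    by_contra hne
    exact (hvpos p v hne).ne' (hv v)
  · -- cylinder property
    rintro ⟨z, t⟩ v w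
    show val (z, t) v w = val (z, t) _ _ + v.2 * w.2
    rw [hvapply, hvapply, hcyl (z, t) v w]
    dsimp only
    ring

/-- **Where the cut-off vanishes the deformed metric is the original one** (`a(t) = 0`: Thm. 27
(h), "`f = g` on `M ∖ U`"). [cite: BarHanke2023, §3, Thm. 27] -/
theorem cylNormalDeform_val_of_eq_zero
    {G' : PseudoRiemannianMetric (I'.prod 𝓘(ℝ, ℝ)) ∞ (E' × ℝ)
      (TangentSpace (I'.prod 𝓘(ℝ, ℝ)) : N × ℝ → Type _)}
    {B : Π z : N, TangentSpace I' z →L[ℝ] TangentSpace I' z →L[ℝ] ℝ} {μ : N → ℝ} {a χ : ℝ → ℝ}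
    {C : ℝ}
    (hval : ∀ (z : N) (t : ℝ) (v w : TangentSpace (I'.prod 𝓘(ℝ, ℝ)) (z, t)),
      G'.val (z, t) v w = (1 - a t) * G.val (z, t) v w +
        a t * ((1 - (C * t ^ 2 + 2 * μ z * χ t)) *
            G.val (z, (0 : ℝ)) ((v.1, 0) : TangentSpace (I'.prod 𝓘(ℝ, ℝ)) (z, (0 : ℝ)))
              ((w.1, 0) : TangentSpace (I'.prod 𝓘(ℝ, ℝ)) (z, (0 : ℝ))) +
          (t - χ t) * B z v.1 w.1 + v.2 * w.2))
    {t : ℝ} (ht : a t = 0) (z : N) : G'.val (z, t) = G.val (z, t) := by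
  ext v w
  rw [hval, ht]
  ring

/-- **Where `a = 1` and `χ(t) = t` the slices are in `C`-normal form with second fundamental form
`k = μ g₀`**: `G'_{(z,t)}((v,0),(w,0)) = (1 - 2 μ(z) t - C t²) g₀(z)(v,w)` (Bär–Hanke, Def. 21
with `h = k = μ g₀`; Thm. 27 (d), (f)). [cite: BarHanke2023, §3, Def. 21 and Thm. 27] -/
theorem cylNormalDeform_hor_of_eq_one
    {G' : PseudoRiemannianMetric (I'.prod 𝓘(ℝ, ℝ)) ∞ (E' × ℝ)
      (TangentSpace (I'.prod 𝓘(ℝ, ℝ)) : N × ℝ → Type _)}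
    {B : Π z : N, TangentSpace I' z →L[ℝ] TangentSpace I' z →L[ℝ] ℝ} {μ : N → ℝ} {a χ : ℝ → ℝ}
    {C : ℝ}
    (hval : ∀ (z : N) (t : ℝ) (v w : TangentSpace (I'.prod 𝓘(ℝ, ℝ)) (z, t)),
      G'.val (z, t) v w = (1 - a t) * G.val (z, t) v w +
        a t * ((1 - (C * t ^ 2 + 2 * μ z * χ t)) *
            G.val (z, (0 : ℝ)) ((v.1, 0) : TangentSpace (I'.prod 𝓘(ℝ, ℝ)) (z, (0 : ℝ)))
              ((w.1, 0) : TangentSpace (I'.prod 𝓘(ℝ, ℝ)) (z, (0 : ℝ))) +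
          (t - χ t) * B z v.1 w.1 + v.2 * w.2))
    {t : ℝ} (hat : a t = 1) (hχt : χ t = t) (z : N) (v w : E') :
    G'.val (z, t) ((v, 0) : TangentSpace (I'.prod 𝓘(ℝ, ℝ)) (z, t))
        ((w, 0) : TangentSpace (I'.prod 𝓘(ℝ, ℝ)) (z, t)) =
      (1 - 2 * μ z * t - C * t ^ 2) *
        G.val (z, (0 : ℝ)) ((v, 0) : TangentSpace (I'.prod 𝓘(ℝ, ℝ)) (z, (0 : ℝ)))
          ((w, 0) : TangentSpace (I'.prod 𝓘(ℝ, ℝ)) (z, (0 : ℝ))) := by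
  rw [hval, hat, hχt]
  show (1 - 1) * _ + 1 * ((1 - (C * t ^ 2 + 2 * μ z * t)) * _ + (t - t) * B z v w + (0 : ℝ) * 0) = _
  ring

end Literature.Geometry.Riemannian

end
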